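import Literature.NumberTheory.EllipticCurves.TianYuanZhang2017.GenusDescentAbstract
import Literature.NumberTheory.EllipticCurves.TianYuanZhang2017.GenusDescentBrackets
import Literature.NumberTheory.EllipticCurves.TianYuanZhang2017.GenusDescentTwist
import Literature.NumberTheory.EllipticCurves.TianYuanZhang2017.GenusDescentDefs
import HarnessLib

/-!
# Tian–Yuan–Zhang, W2: U⁺ PROVED from the displayed §3 statements — `uPlus_genusField_of`

W2 (p2-lead ML-48/ML-56; idea-2's U⁺ note, second reader p2-lit-1, third reader p2-ref; kernel p2-monsky-lit GEN 8),
file 6/6.  **Theorem (`W2.uPlus_genusField_of`).**  Assume p2-lit-1's displayed fact `tyz_genusPointData`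
(Tian–Yuan–Zhang §3: Prop. 3.4, Thm. 3.5 main clause WITH `ρ` and `α_n`, Lemma 3.18, the Galois facts on `β′`,
Lemma 3.21, for data `GenusPointData n`) and GZK (`rank_eq_analyticRank_of_analyticRank_le_one`).  Then for every
square-free `n ≡ 5, 6, 7 (mod 8)` there is an integer `L` with `IsScriptL n L` such that: if `n ≡ 5, 7` and `2 ∣ L`
then `genusSum₁ n gK` and `genusSum₂' n gK` are even; if `n ≡ 6` and `2 ∣ L` then `genusSum₂' n gK` is even
(`gK d = genusClassNumber (GenusField d)`).  This is Thm. 3.5's second bullet with its hypothesis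
"`P(n) ∈ A(K_n)⁻ + A[4]`, i.e. `2^{−ρ(n)}𝓛(n)` even" REPLACED by "`𝓛(n)` even" — the `ρ`-FREE parity statement
U⁺ — obtained by running the printed proof of Thm. 3.5 (2) (p0020 L107–L165) on the `E`-side relation
`2φ(P(n)) − ε𝓛(n)R ∈ E_tors` instead of L122/L146 (LAYER A, `GenusDescentAbstract`).
Steps here: `tau_facts` (τ-table orders, from the display's §1b), `stub_K4'` (β′ fixes `A(ℍ′_n)_tor`, `n` odd:
the 8 points with `2t ∈ {0, τ(1)}`), `stub_K5'` (the P-a assembly: `β′+1` applied to Prop. 3.4, Lemma 3.21 per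
block, `β′[i] = [i]β′`), the glue, and the composition through `GenusDescentEnSide` (index lemma, "no ρ left"),
`GenusDescentTwist` (twist transfer + halving) and `GenusDescentBrackets` (brackets = genus sums).
HONEST FRAMING: U⁺ is hereby a theorem MODULO the displayed printed statements of TYZ §3 (`tyz_genusPointData`,
ONE named fact, p2-lit-1) and GZK by name — it is NOT a Literature fact and nothing about BSD is asserted here;
the count-moving doors are the typer's.  No `def … : Prop`, no sorry.

## References
* Y. Tian, X. Yuan, S.-W. Zhang, *Genus periods, genus points and congruent number problem*, Asian J. Math. 21
  (2017) 721–774, arXiv:1411.4728; Thm. 1.2, §3 (Prop. 3.4, Thm. 3.5, Lemmas 3.16–3.21). [TianYuanZhang2017]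
-/

noncomputable section

open scoped Classical

namespace Literature.NumberTheory.EllipticCurves.TianYuanZhang2017.W2

open _root_.WeierstrassCurve _root_.WeierstrassCurve.Affine
open Literature.NumberTheory.EllipticCurves
open Literature.NumberTheory.EllipticCurves.TianYuanZhang2017

section GPD

variable {n : ℕ}

/-! ### `τ`-orders and `β′` on torsion -/

/-- **τ-table order facts** (from the display's §1b lemmas): `2τ(1) = 0`,
`2τ(1/2) = τ(1)`, `2τ(i/2) = τ(1)`, `2τ((1−i)/2) = 0`, `τ((1−i)/2) ∉ ℤτ(1)`, `2·[i]τ((1−i)/2) = 0`,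
`[i]τ((1−i)/2) ∉ ℤτ(1)`. [cite: TianYuanZhang2017, Thm. 3.5 and its proof (chunks p0011 L94–L112, p0020 L107–L165, p0021 L1–L3)] -/
theorem tau_facts (D : GenusPointData n) :
    (2 : ℕ) • (tauOne : APoint D.H) = 0 ∧ (2 : ℕ) • (tauHalf : APoint D.H) = tauOne ∧
    (2 : ℕ) • D.tauIHalf = tauOne ∧ (2 : ℕ) • D.tauHalfOneMinusI = 0 ∧
    D.tauHalfOneMinusI ∉ AddSubgroup.zmultiples (tauOne : APoint D.H) ∧
    (2 : ℕ) • D.iPt D.tauHalfOneMinusI = 0 ∧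
    D.iPt D.tauHalfOneMinusI ∉ AddSubgroup.zmultiples (tauOne : APoint D.H) := by
  have h2 : (2 : ℕ) • (tauOne : APoint D.H) = 0 := two_nsmul_tauOne
  have hmem : ∀ x : APoint D.H, x ∈ AddSubgroup.zmultiples (tauOne : APoint D.H) ↔ x = 0 ∨ x = tauOne :=
    fun x => W2.Abstract.mem_zmultiples_iff_of_two_nsmul_eq_zero h2
  have ha : D.tauHalfOneMinusI ∉ AddSubgroup.zmultiples (tauOne : APoint D.H) := by
    rw [hmem]
    rintro (h0 | h0)
    · exact tauHalf_sub_cmI_tauHalf_ne_zero D.im D.im_sq h0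
    · exact tauHalf_sub_cmI_tauHalf_ne_tauOne D.im D.im_sq h0
  refine ⟨h2, two_nsmul_tauHalf, two_nsmul_cmI_tauHalf D.im D.im_sq,
    two_nsmul_tauHalf_sub_cmI_tauHalf D.im D.im_sq, ha, ?_, ?_⟩
  · show (2 : ℕ) • (cmI D.im D.im_sq) ((tauHalf : APoint D.H) - cmI D.im D.im_sq tauHalf) = 0
    rw [← map_nsmul, two_nsmul_tauHalf_sub_cmI_tauHalf D.im D.im_sq, map_zero]
  · -- `[i]x ∈ {0, τ(1)}` with `[i]τ(1) = τ(1)` and `[i]` injective forces `x ∈ {0, τ(1)}`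
    rw [hmem]
    rintro (h0 | h0)
    · exact tauHalf_sub_cmI_tauHalf_ne_zero D.im D.im_sq
        ((EmbeddingLike.map_eq_zero_iff (f := D.iPt)).mp h0)
    · apply tauHalf_sub_cmI_tauHalf_ne_tauOne D.im D.im_sq
      apply (cmI D.im D.im_sq).injective
      change cmI D.im D.im_sq ((tauHalf : APoint D.H) - cmI D.im D.im_sq tauHalf) = tauOne at h0
      rw [cmI_tauOne]
      exact h0

/-- **K4′** (`β′` FIXES `A(ℍ′_n)_tor` for odd `n`; was `stub_K4'`): by `lemma318` every torsion point has
`2Q ∈ {0, τ(1)}`, hence is one of the eight points `O, (0,0), (±2i,0), (2,±4), (−2,±4i)` with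
coordinates in `ℚ(i)`, fixed by `β` since `β(i) = i` (`betaSpec`). [cite: TianYuanZhang2017, Thm. 3.5 and its proof (chunks p0011 L94–L112, p0020 L107–L165, p0021 L1–L3)] -/
theorem stub_K4' (D : GenusPointData n) (h318 : D.lemma318) (hβ : D.betaSpec) (hn : Odd n)
    (t : APoint D.H) (ht : IsOfFinAddOrder t) : D.betaPt t = t := by
  obtain ⟨-, h2t⟩ := h318.1 hn t ht
  obtain ⟨h1, h2, h3, h4, -⟩ := curveA_baseChange_a (H := D.H)
  have hi : (D.beta.toAlgHom : D.H → D.H) D.im = D.im := hβ.2.1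
  have him := D.im_sq
  have hfix : ∀ {x y : D.H} (h : (curveA.baseChange D.H).toAffine.Nonsingular x y),
      (D.beta.toAlgHom : D.H → D.H) x = x → (D.beta.toAlgHom : D.H → D.H) y = y →
      D.betaPt (.some x y h) = .some x y h := by
    intro x y h hx hy
    change Point.map D.beta.toAlgHom (.some x y h) = _
    rw [Point.map_some, Point.some.injEq]
    exact ⟨hx, hy⟩
  rcases t with _ | ⟨x, y, h⟩
  · exact map_zero _
  · have heq : y ^ 2 = x ^ 3 + 4 * x := (curveA_nonsingular_iff x y).mp h
    have hnegY : (curveA.baseChange D.H).toAffine.negY x y = -y := by rw [negY, h1, h3]; ring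
    rcases h2t with h0 | h0
    · -- `2t = 0`: `t = (x, 0)` with `x(x² + 4) = 0`
      have hy : y = 0 := by
        by_contra hy0
        have hne : y ≠ (curveA.baseChange D.H).toAffine.negY x y := by
          rw [hnegY]; intro e; apply hy0; linear_combination e / 2
        rw [two_nsmul, Point.add_self_of_Y_ne hne] at h0
        exact Point.some_ne_zero _ h0
      subst hy
      have hx : x = 0 ∨ x = 2 * D.im ∨ x = -(2 * D.im) := by
        have h0' : x * (x - 2 * D.im) * (x + 2 * D.im) = 0 := by
          linear_combination (-1 : D.H) * heq + (-4 * x) * him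
        rcases mul_eq_zero.mp h0' with h' | h'
        · rcases mul_eq_zero.mp h' with h'' | h''
          · exact Or.inl h''
          · exact Or.inr (Or.inl (by linear_combination h''))
        · exact Or.inr (Or.inr (by linear_combination h'))
      refine hfix h ?_ (map_zero _)
      rcases hx with rfl | rfl | rfl
      · exact map_zero _
      · rw [map_mul, hi, map_ofNat]
      · rw [map_neg, map_mul, hi, map_ofNat]
    · -- `2t = τ(1) = (0,0)`: `x = ±2`, `y ∈ {±4, ±4i}`
      have hne : y ≠ (curveA.baseChange D.H).toAffine.negY x y := by
        intro e
        rw [two_nsmul, Point.add_of_Y_eq rfl e] at h0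
        exact tauOne_ne_zero (H := D.H) h0.symm
      have hy0 : y ≠ 0 := by intro hy; apply hne; rw [hnegY, hy, neg_zero]
      rw [two_nsmul, Point.add_self_of_Y_ne hne, tauOne] at h0
      have hX := (Point.some.inj h0).1
      set L := (curveA.baseChange D.H).toAffine.slope x x y y with hL
      have hLdef : L = (3 * x ^ 2 + 4) / (2 * y) := by
        rw [hL, slope_of_Y_ne rfl hne, hnegY, h1, h2, h4]; ring
      have hX' : L ^ 2 = 2 * x := by
        rw [addX, h1, h2] at hX; linear_combination hX
      have hmul : L * (2 * y) = 3 * x ^ 2 + 4 := by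
        rw [hLdef, div_mul_cancel₀ _ (mul_ne_zero two_ne_zero hy0)]
      have hx2 : x ^ 2 = 4 := by
        have key : (x ^ 2 - 4) ^ 2 = 0 := by
          have e1 : (3 * x ^ 2 + 4) ^ 2 = L ^ 2 * (2 * y) ^ 2 := by rw [← hmul]; ring
          rw [hX'] at e1
          linear_combination e1 + 8 * x * heq
        have := (pow_eq_zero_iff (n := 2) (by norm_num)).mp key
        linear_combination this
      have hx : x = 2 ∨ x = -2 := by
        have e : (x - 2) * (x + 2) = 0 := by linear_combination hx2
        rcases mul_eq_zero.mp e with h' | h'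
        · left; linear_combination h'
        · right; linear_combination h'
      rcases hx with rfl | rfl
      · have hy : y = 4 ∨ y = -4 := by
          have e : (y - 4) * (y + 4) = 0 := by linear_combination heq
          rcases mul_eq_zero.mp e with h' | h'
          · left; linear_combination h'
          · right; linear_combination h'
        refine hfix h (map_ofNat _ 2) ?_
        rcases hy with rfl | rfl
        · exact map_ofNat _ 4
        · rw [map_neg, map_ofNat]
      · have hy : y = 4 * D.im ∨ y = -(4 * D.im) := by
          have e : (y - 4 * D.im) * (y + 4 * D.im) = 0 := by linear_combination heq - 16 * him
          rcases mul_eq_zero.mp e with h' | h'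
          · left; linear_combination h'
          · right; linear_combination h'
        refine hfix h (by rw [map_neg, map_ofNat]) ?_
        rcases hy with rfl | rfl
        · rw [map_mul, hi, map_ofNat]
        · rw [map_neg, map_mul, hi, map_ofNat]

/-- For odd `n` there is no `(5,3,2)`-block (it needs an even block). [cite: TianYuanZhang2017, Thm. 3.5 and its proof (chunks p0011 L94–L112, p0020 L107–L165, p0021 L1–L3)] -/
theorem cI_eq_zero_of_odd (hn : Odd n) : cI n = 0 := by
  refine Finset.sum_eq_zero fun S hS => Finset.sum_eq_zero fun d₀ hd₀ => ?_
  exfalso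
  obtain ⟨-, -, -, -, h2⟩ := Finset.mem_filter.mp hd₀
  obtain ⟨e, he⟩ := Finset.card_pos.mp (by rw [h2]; exact Nat.one_pos)
  have he' := Finset.mem_filter.mp he
  have := odd_of_mem_decompositions hn hS (Finset.mem_of_mem_erase he'.1)
  omega

/-! ### K5′ — the P-a assembly -/

/-- `[i]τ(1) = τ(1)` for the data's `[i]` (display §1b `cmI_tauOne`). [cite: TianYuanZhang2017, Thm. 3.5 and its proof (chunks p0011 L94–L112, p0020 L107–L165, p0021 L1–L3)] -/
theorem iPt_tauOne (D : GenusPointData n) : D.iPt tauOne = tauOne := cmI_tauOne D.im D.im_sq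

/-- `β′` commutes with `[i]` on `A(ℍ′_n)` (`betaSpec`: `β(i) = i`; `[i](X,Y) = (−X, iY)`). [cite: TianYuanZhang2017, Thm. 3.5 and its proof (chunks p0011 L94–L112, p0020 L107–L165, p0021 L1–L3)] -/
theorem betaPt_iPt (D : GenusPointData n) (hβ : D.betaSpec) (Q : APoint D.H) :
    D.betaPt (D.iPt Q) = D.iPt (D.betaPt Q) := by
  rcases Q with _ | ⟨x, y, h⟩
  · show D.betaPt (D.iPt 0) = D.iPt (D.betaPt 0)
    simp only [map_zero]
  · change Point.map D.beta.toAlgHom (cmI D.im D.im_sq (.some x y h)) =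
      cmI D.im D.im_sq (Point.map D.beta.toAlgHom (.some x y h))
    rw [cmI_some, Point.map_some, Point.map_some, cmI_some]
    have hi : (D.beta.toAlgHom : D.H → D.H) D.im = D.im := hβ.2.1
    simp only [map_neg, map_mul, hi]

/-- `N_A ∘ [i] = [i] ∘ N_A` (`β′(i) = i`). [cite: TianYuanZhang2017, Thm. 3.5 and its proof (chunks p0011 L94–L112, p0020 L107–L165, p0021 L1–L3)] -/
theorem normA_iPt (D : GenusPointData n) (hβ : D.betaSpec) (Q : APoint D.H) :
    normA D (D.iPt Q) = D.iPt (normA D Q) := by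
  rw [normA_apply, normA_apply, betaPt_iPt D hβ, map_add]

/-- ONE main block: `(∏_{d ≠ d₀} g)·(β′+1)(ε-type Z(d₀)) − (∏_S g)·τ_type ∈ ℤτ(1)` (Lemma 3.21 + `β[i] = [i]β`). [cite: TianYuanZhang2017, Thm. 3.5 and its proof (chunks p0011 L94–L112, p0020 L107–L165, p0021 L1–L3)] -/
theorem main_term_mem (D : GenusPointData n) (hsq : Squarefree n) (h8 : n % 8 = 5 ∨ n % 8 = 6 ∨ n % 8 = 7)
    (h321 : D.lemma321) (hβ : D.betaSpec) {S : Finset ℕ} (hS : S ∈ decompositions n) {d₀ : ℕ}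
    (hd₀ : d₀ ∈ S.filter (fun d₀ => MainBlock S d₀)) :
    (∏ d ∈ S.erase d₀, gK d) •
        normA D (if d₀ % 8 = 5 ∧ ∃ d ∈ S, d % 8 = 3 then D.iPt (D.Z d₀) else D.Z d₀) -
      (∏ d ∈ S, gK d) • tauType D S d₀ ∈ AddSubgroup.zmultiples (tauOne : APoint D.H) := by
  obtain ⟨hd₀S, hM⟩ := Finset.mem_filter.mp hd₀
  have hdiv : d₀ ∈ n.divisors := Nat.mem_divisors.mpr ⟨dvd_of_mem_decompositions hS hd₀S, hsq.ne_zero⟩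
  rw [← Finset.prod_erase_mul S gK hd₀S]
  set c := ∏ d ∈ S.erase d₀, gK d
  rcases hM.1 with h5 | h6 | h7
  · obtain ⟨m, hm⟩ := (h321 d₀ hdiv).1 h5
    by_cases h3 : ∃ d ∈ S, d % 8 = 3
    · rw [if_pos ⟨h5, h3⟩, tauType, if_pos h5, if_pos h3, normA_iPt D hβ, normA_apply, hm, map_add,
        map_zsmul, map_zsmul, iPt_tauOne]
      exact AddSubgroup.mem_zmultiples_iff.mpr ⟨(c : ℤ) * m, by module⟩
    · rw [if_neg (fun h => h3 h.2), tauType, if_pos h5, if_neg h3, normA_apply, hm]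
      exact AddSubgroup.mem_zmultiples_iff.mpr ⟨(c : ℤ) * m, by module⟩
  · have hn6 : n % 8 = 6 := by
      rcases h8 with h | h | h
      · exfalso; have := odd_of_mem_decompositions (Nat.odd_iff.mpr (by omega)) hS hd₀S; omega
      · exact h
      · exfalso; have := odd_of_mem_decompositions (Nat.odd_iff.mpr (by omega)) hS hd₀S; omega
    obtain ⟨m, hm⟩ := (h321 d₀ hdiv).2.1 h6 (mod_sixteen_of_six_six hn6 hS hd₀S hM h6)
    rw [if_neg (fun h => absurd h.1 (by omega)), tauType, if_neg (by omega), if_pos h6, normA_apply, hm]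
    exact AddSubgroup.mem_zmultiples_iff.mpr ⟨(c : ℤ) * m, by module⟩
  · rw [if_neg (fun h => absurd h.1 (by omega)), tauType, if_neg (by omega), if_neg (by omega),
      normA_apply, (h321 d₀ hdiv).2.2 h7, smul_smul, sub_self]
    exact zero_mem _

/-- ONE `(5,3,2)`-block: `(∏_{d ≠ d₀} g)·(β′+1)([i]Z(d₀)) − (∏_S g)·[i]τa ∈ ℤτ(1)`. [cite: TianYuanZhang2017, Thm. 3.5 and its proof (chunks p0011 L94–L112, p0020 L107–L165, p0021 L1–L3)] -/
theorem i_term_mem (D : GenusPointData n) (hsq : Squarefree n) (h321 : D.lemma321) (hβ : D.betaSpec)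
    {S : Finset ℕ} (hS : S ∈ decompositions n) {d₀ : ℕ} (hd₀ : d₀ ∈ S.filter (fun d₀ => IBlock S d₀)) :
    (∏ d ∈ S.erase d₀, gK d) • normA D (D.iPt (D.Z d₀)) - (∏ d ∈ S, gK d) • D.iPt D.tauHalfOneMinusI ∈
      AddSubgroup.zmultiples (tauOne : APoint D.H) := by
  obtain ⟨hd₀S, hI⟩ := Finset.mem_filter.mp hd₀
  have hdiv : d₀ ∈ n.divisors := Nat.mem_divisors.mpr ⟨dvd_of_mem_decompositions hS hd₀S, hsq.ne_zero⟩
  rw [← Finset.prod_erase_mul S gK hd₀S]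
  set c := ∏ d ∈ S.erase d₀, gK d
  obtain ⟨m, hm⟩ := (h321 d₀ hdiv).1 hI.1
  rw [normA_iPt D hβ, normA_apply, hm, map_add, map_zsmul, map_zsmul, iPt_tauOne]
  exact AddSubgroup.mem_zmultiples_iff.mpr ⟨(c : ℤ) * m, by module⟩

/-- `(β′+1)(Σ_main) − Σ_S Σ_{d₀ main} (∏_S g)·τ_type ∈ ℤτ(1)`. [cite: TianYuanZhang2017, Thm. 3.5 and its proof (chunks p0011 L94–L112, p0020 L107–L165, p0021 L1–L3)] -/
theorem normA_prop34SumMain_sub_mem (D : GenusPointData n) (hsq : Squarefree n)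
    (h8 : n % 8 = 5 ∨ n % 8 = 6 ∨ n % 8 = 7) (h321 : D.lemma321) (hβ : D.betaSpec) :
    normA D D.prop34SumMain -
        ∑ S ∈ decompositions n, ∑ d₀ ∈ S.filter (fun d₀ => MainBlock S d₀), (∏ d ∈ S, gK d) • tauType D S d₀ ∈
      AddSubgroup.zmultiples (tauOne : APoint D.H) := by
  have hdef : D.prop34SumMain = ∑ S ∈ decompositions n, ∑ d₀ ∈ S.filter (fun d₀ => MainBlock S d₀),
      (∏ d ∈ S.erase d₀, gK d) • (if d₀ % 8 = 5 ∧ ∃ d ∈ S, d % 8 = 3 then D.iPt (D.Z d₀) else D.Z d₀) := rfl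
  rw [hdef, map_sum, ← Finset.sum_sub_distrib]
  refine sum_mem fun S hS => ?_
  rw [map_sum, ← Finset.sum_sub_distrib]
  refine sum_mem fun d₀ hd₀ => ?_
  rw [map_nsmul]
  exact main_term_mem D hsq h8 h321 hβ hS hd₀

/-- The bracket split: `Σ_S Σ_{d₀ main} (∏_S g)·τ_type = B₅·τa + B₅ᵢ·[i]τa + B₆·τ(i/2) + B₇·τ(1/2)`. [cite: TianYuanZhang2017, Thm. 3.5 and its proof (chunks p0011 L94–L112, p0020 L107–L165, p0021 L1–L3)] -/
theorem sum_tauType_eq (D : GenusPointData n) :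
    ∑ S ∈ decompositions n, ∑ d₀ ∈ S.filter (fun d₀ => MainBlock S d₀), (∏ d ∈ S, gK d) • tauType D S d₀ =
      bFivePlain n • D.tauHalfOneMinusI + bFiveI n • D.iPt D.tauHalfOneMinusI + bSix n • D.tauIHalf +
        bSeven n • (tauHalf : APoint D.H) := by
  simp only [bFivePlain, bFiveI, bSix, bSeven, coef, Finset.sum_smul, ← Finset.sum_add_distrib]
  refine Finset.sum_congr rfl fun S _ => Finset.sum_congr rfl fun d₀ hd₀ => ?_
  have h567 : d₀ % 8 = 5 ∨ d₀ % 8 = 6 ∨ d₀ % 8 = 7 := (Finset.mem_filter.mp hd₀).2.1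
  by_cases h3 : ∃ d ∈ S, d % 8 = 3
  · rcases h567 with h | h | h <;> simp [tauType, QFivePlain, QFiveI, QSix, QSeven, h, h3]
  · rcases h567 with h | h | h <;> simp [tauType, QFivePlain, QFiveI, QSix, QSeven, h, h3]

/-- `(β′+1)(i·Σ_{(5,3,2)}) − C·[i]τa ∈ ℤτ(1)`. [cite: TianYuanZhang2017, Thm. 3.5 and its proof (chunks p0011 L94–L112, p0020 L107–L165, p0021 L1–L3)] -/
theorem normA_prop34SumI_sub_mem (D : GenusPointData n) (hsq : Squarefree n) (h321 : D.lemma321)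
    (hβ : D.betaSpec) :
    normA D D.prop34SumI - cI n • D.iPt D.tauHalfOneMinusI ∈ AddSubgroup.zmultiples (tauOne : APoint D.H) := by
  have hdef : D.prop34SumI = ∑ S ∈ decompositions n, ∑ d₀ ∈ S.filter (fun d₀ => IBlock S d₀),
      (∏ d ∈ S.erase d₀, gK d) • D.iPt (D.Z d₀) := rfl
  rw [hdef, cI, map_sum, Finset.sum_smul, ← Finset.sum_sub_distrib]
  refine sum_mem fun S hS => ?_
  rw [map_sum, Finset.sum_smul, ← Finset.sum_sub_distrib]
  refine sum_mem fun d₀ hd₀ => ?_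
  rw [map_nsmul]
  exact i_term_mem D hsq h321 hβ hS hd₀

/-- **K5′** (P-a ASSEMBLY of the bracket relation, all three classes at once; was `stub_K5'`): apply
`β′ + 1` to `prop34`, evaluate `(β′+1)Z(d₀)` by `lemma321` (block `≡ 6`: `d₀ ≡ n (mod 16)` by
`mod_sixteen_of_six_six`), commute `β′` past `[i]` (`betaSpec`: `β(i) = i`), and collect the multiples of
`τ(1)`: `B₅•τa + B₅ᵢ•[i]τa + B₆•τ(i/2) + B₇•τ(1/2) + C•[i]τa − (β′+1)P(n) ∈ (β′+1)(2A(ℍ′_n)) + ℤτ(1)`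
(p0020 L123–134 / L149–164 with `(β′+1)P(n)` NOT substituted). [cite: TianYuanZhang2017, Thm. 3.5 and its proof (chunks p0011 L94–L112, p0020 L107–L165, p0021 L1–L3)] -/
theorem stub_K5' (D : GenusPointData n) (hsq : Squarefree n) (h8 : n % 8 = 5 ∨ n % 8 = 6 ∨ n % 8 = 7)
    (h34 : D.prop34) (h321 : D.lemma321) (hβ : D.betaSpec) :
    ∃ (a : APoint D.H) (k : ℤ),
      (bFivePlain n : ℤ) • D.tauHalfOneMinusI + (bFiveI n : ℤ) • D.iPt D.tauHalfOneMinusI +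
        (bSix n : ℤ) • D.tauIHalf + (bSeven n : ℤ) • (tauHalf : APoint D.H) +
        (cI n : ℤ) • D.iPt D.tauHalfOneMinusI - normA D (D.P n) =
      normA D ((2 : ℕ) • a) + k • tauOne := by
  obtain ⟨Q, hQ⟩ := h34
  have hmain := normA_prop34SumMain_sub_mem D hsq h8 h321 hβ
  rw [sum_tauType_eq] at hmain
  obtain ⟨k₁, hk₁⟩ := AddSubgroup.mem_zmultiples_iff.mp hmain
  obtain ⟨k₂, hk₂⟩ := AddSubgroup.mem_zmultiples_iff.mp (normA_prop34SumI_sub_mem D hsq h321 hβ)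
  have e1 : normA D D.prop34SumMain = k₁ • tauOne + (bFivePlain n • D.tauHalfOneMinusI +
      bFiveI n • D.iPt D.tauHalfOneMinusI + bSix n • D.tauIHalf + bSeven n • (tauHalf : APoint D.H)) := by
    rw [hk₁, sub_add_cancel]
  have e2 : normA D D.prop34SumI = k₂ • tauOne + cI n • D.iPt D.tauHalfOneMinusI := by
    rw [hk₂, sub_add_cancel]
  have hP : D.P n = D.prop34SumMain + D.prop34SumI + (2 : ℕ) • Q := by rw [← hQ]; abel
  refine ⟨-Q, -(k₁ + k₂), ?_⟩
  rw [hP, map_add, map_add, e1, e2]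
  simp only [map_nsmul, map_neg, add_smul, neg_smul, natCast_zsmul, smul_neg]
  abel

/-! ### Proved glue of the fixed-`A` model -/

/-- `β ∘ ι_{K_n} = ι_{K_n} ∘ conj` on `K_n = GenusField n` (from `betaSpec`: `β(√−n) = −√−n`; an
`ℚ`-algebra map out of `ℚ[X]/(X² + n)` is determined by the image of the root). [cite: TianYuanZhang2017, Thm. 3.5 and its proof (chunks p0011 L94–L112, p0020 L107–L165, p0021 L1–L3)] -/
theorem beta_comp_embK (D : GenusPointData n) (hn : n ∈ n.divisors) (hβ : D.betaSpec) :
    D.beta.toAlgHom.comp (D.embK n hn) = (D.embK n hn).comp (genusFieldConj n) := by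
  apply AdjoinRoot.algHom_ext
  have h1 : (D.embK n hn) (AdjoinRoot.root (genusFieldPoly n)) = D.sqrtNeg n :=
    AdjoinRoot.liftAlgHom_root _ _ _ _
  have h2 : (genusFieldConj n) (AdjoinRoot.root (genusFieldPoly n)) = -AdjoinRoot.root (genusFieldPoly n) :=
    AdjoinRoot.liftAlgHom_root _ _ _ _
  show D.beta.toAlgHom (D.embK n hn (AdjoinRoot.root (genusFieldPoly n))) =
    D.embK n hn (genusFieldConj n (AdjoinRoot.root (genusFieldPoly n)))
  rw [h1, h2, map_neg, h1]
  exact hβ.1 hn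

/-- `N_E` kills the image of the minus part: for `γ ∈ A₂(K_n)` with `conj γ = −γ`,
`(β + 1)(ι γ) = 0`. [cite: TianYuanZhang2017, Thm. 3.5 and its proof (chunks p0011 L94–L112, p0020 L107–L165, p0021 L1–L3)] -/
theorem normE_map_embK (D : GenusPointData n) (hn : n ∈ n.divisors) (hβ : D.betaSpec)
    (γ : A2Point (GenusField n))
    (hγ : Point.map (W' := curveA.twoIsogenyCodomain) (genusFieldConj n) γ = -γ) :
    normE D (Point.map (W' := curveA.twoIsogenyCodomain) (D.embK n hn) γ) = 0 := by
  have key : Point.map (W' := curveA.twoIsogenyCodomain) D.beta.toAlgHom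
      (Point.map (W' := curveA.twoIsogenyCodomain) (D.embK n hn) γ) =
      -Point.map (W' := curveA.twoIsogenyCodomain) (D.embK n hn) γ := by
    rw [Point.map_map, beta_comp_embK D hn hβ, ← Point.map_map, hγ, map_neg]
  simp only [normE, AddMonoidHom.add_apply, AddMonoidHom.id_apply, key, neg_add_cancel]

/-- `Θ_A(α₀)` generates `A(K_n)⁻` modulo torsion when `α₀` generates `A_n′(ℚ)` modulo torsion. [cite: TianYuanZhang2017, Thm. 3.5 and its proof (chunks p0011 L94–L112, p0020 L107–L165, p0021 L1–L3)] -/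
theorem generatesFreePart_of_twist [(congruentNumberCurve n).IsElliptic]
    (ΘA : (congruentNumberCurve n).twoIsogenyCodomain.toAffine.Point →+ APoint (GenusField n))
    (hmem : ∀ P, ΘA P ∈ minusPart n) (hsurj : ∀ γ ∈ minusPart n, ∃ P, ΘA P = γ)
    {α₀ : (congruentNumberCurve n).twoIsogenyCodomain.toAffine.Point}
    (hα₀ : ∀ x, ∃ k : ℤ, IsOfFinAddOrder (x - k • α₀)) : GeneratesFreePart n (ΘA α₀) := by
  refine ⟨hmem α₀, fun γ hγ => ?_⟩
  obtain ⟨P, rfl⟩ := hsurj γ hγ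
  obtain ⟨k, hk⟩ := hα₀ P
  exact ⟨k, by simpa only [map_sub, map_zsmul] using ΘA.isOfFinAddOrder hk⟩

/-- **Step 1E in the fixed model:** from F1-with-`ρ` (`thm35Main`'s relation for `α = Θ_A α₀`),
the `E_n`-side index lemma `ψ_ℚ α₀ = ε2^ρ R + t₂` pushed through `Θ_E` and the intertwining
`φ_A ∘ Θ_A = Θ_E ∘ ψ_ℚ`, to `2•φ_H(P(n)) − (sε𝓛)•R′_H ∈ tors`, `R′_H = ι(Θ_E R)`. [cite: TianYuanZhang2017, Thm. 3.5 and its proof (chunks p0011 L94–L112, p0020 L107–L165, p0021 L1–L3)] -/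
theorem step1E_fixed (D : GenusPointData n) (hn : n ∈ n.divisors) [(congruentNumberCurve n).IsElliptic]
    (ΘA : (congruentNumberCurve n).twoIsogenyCodomain.toAffine.Point →+ APoint (GenusField n))
    (ΘE : (congruentNumberCurve n).toAffine.Point →+ A2Point (GenusField n))
    (hinter : ∀ P, curveA.twoIsogenyPointsHom (GenusField n) (ΘA P) = ΘE (ψQ n P))
    {ρ : ℕ} {L s ε : ℤ} {α₀ : (congruentNumberCurve n).twoIsogenyCodomain.toAffine.Point}
    {R t₂ : (congruentNumberCurve n).toAffine.Point}
    (hF1 : IsOfFinAddOrder (((2 : ℤ) ^ (ρ + 1)) • D.P n -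
      (s * L) • Point.map (W' := curveA) (D.embK n hn) (ΘA α₀)))
    (ht₂ : (2 : ℕ) • t₂ = 0) (hψα : ψQ n α₀ = (ε * 2 ^ ρ) • R + t₂) :
    IsOfFinAddOrder ((2 : ℕ) • φH D (D.P n) -
      (s * ε * L) • Point.map (W' := curveA.twoIsogenyCodomain) (D.embK n hn) (ΘE R)) := by
  have h1 := (φH D).isOfFinAddOrder hF1
  rw [map_sub, map_zsmul, map_zsmul] at h1
  -- `φ_H (ι (Θ_A α₀)) = ι (φ_{K_n} (Θ_A α₀)) = ι (Θ_E (ψ α₀))`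
  have hφι : φH D (Point.map (W' := curveA) (D.embK n hn) (ΘA α₀)) =
      Point.map (W' := curveA.twoIsogenyCodomain) (D.embK n hn) (ΘE (ψQ n α₀)) := by
    rw [φH, ← map_twoIsogenyPointsHom, hinter]
  rw [hφι, hψα, map_add, map_zsmul, map_add, map_zsmul] at h1
  set RH := Point.map (W' := curveA.twoIsogenyCodomain) (D.embK n hn) (ΘE R) with hRH
  set tH := Point.map (W' := curveA.twoIsogenyCodomain) (D.embK n hn) (ΘE t₂) with htH
  have htH2 : (2 : ℕ) • tH = 0 := by rw [htH, ← map_nsmul, ← map_nsmul, ht₂, map_zero, map_zero]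
  have htHfin : IsOfFinAddOrder tH := isOfFinAddOrder_iff_nsmul_eq_zero.mpr ⟨2, by norm_num, htH2⟩
  have h2 : IsOfFinAddOrder ((2 ^ ρ : ℕ) • ((2 : ℕ) • φH D (D.P n) - (s * ε * L) • RH)) := by
    have e : (2 ^ ρ : ℕ) • ((2 : ℕ) • φH D (D.P n) - (s * ε * L) • RH) =
        (((2 : ℤ) ^ (ρ + 1)) • φH D (D.P n) - (s * L) • ((ε * 2 ^ ρ) • RH + tH)) + (s * L) • tH := by
      rw [pow_succ]
      module
    rw [e]
    exact h1.add htHfin.zsmul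
  exact W2.Abstract.isOfFinAddOrder_of_nsmul (pow_ne_zero ρ two_ne_zero) h2

/-! ### THE COMPOSITION: `tyz_genusPointData → GZK → U⁺` for `g` read in `GenusField` -/

/-- **U⁺ (GenusField form) from lit-1's displayed fact + GZK.** [cite: TianYuanZhang2017, Thm. 3.5 and its proof (chunks p0011 L94–L112, p0020 L107–L165, p0021 L1–L3)] -/
theorem uPlus_genusField_of (hTYZ : tyz_genusPointData)
    (hGZK : rank_eq_analyticRank_of_analyticRank_le_one) :
    ∀ (n : ℕ), Squarefree n → (n % 8 = 5 ∨ n % 8 = 6 ∨ n % 8 = 7) →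
      ∃ L : ℤ, IsScriptL n L ∧
        ((n % 8 = 5 ∨ n % 8 = 7) → (2 : ℤ) ∣ L → Even (genusSum₁ n gK) ∧ Even (genusSum₂' n gK)) ∧
        (n % 8 = 6 → (2 : ℤ) ∣ L → Even (genusSum₂' n gK)) := by
  intro n hsq h8
  letI := isElliptic_congruentNumberCurve hsq.ne_zero
  have hn1 : 1 < n := by rcases h8 with h | h | h <;> omega
  have hn : n ∈ n.divisors := Nat.mem_divisors_self n hsq.ne_zero
  obtain ⟨D, hLspec, -, -, h34, h35, -, -, -, h318, hβ, h321⟩ := hTYZ n hsq h8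
  obtain ⟨ρ, hρ⟩ := stub_S3 hsq
  set L := D.scriptL n with hLdef
  have hL : IsScriptL n L := hLspec n hn hn1
  obtain ⟨ΘA, ΘE, hΘAmem, hΘAsurj, hΘAtor, hΘEminus, hinter, hK2⟩ := stub_twist hsq hn
  obtain ⟨hτ1, hτhalf, hτihalf, hτa0, hτa', hτia0, hτia'⟩ := tau_facts D
  -- Steps 1–2: `R′`, `Q₁`, `ε′` with the `E`-side `ρ`-free relation and `N_E R′ = 0`
  have main : ∃ (R' : A2Point D.H) (Q₁ : APoint D.H) (ε' : ℤ),
      normE D R' = 0 ∧ φH D Q₁ = R' ∧ IsOfFinAddOrder ((2 : ℕ) • φH D (D.P n) - (ε' * L) • R') := by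
    by_cases hL0 : L = 0
    · refine ⟨0, 0, 0, map_zero _, map_zero _, ?_⟩
      rw [smul_zero, sub_zero]
      exact ((φH D).isOfFinAddOrder ((h35 hn ρ hρ).1 hL0)).nsmul
    · have har : (congruentNumberCurve n).analyticRank ≤ 1 := S4 hsq h8 hL hL0
      have hr : (congruentNumberCurve n).mordellWeilRank ≤ 1 := by
        rw [(hGZK (congruentNumberCurve n) har).1]; exact har
      obtain ⟨R, hR⟩ := stub_S0 hr
      obtain ⟨α₀, hα₀⟩ := stub_S0' hr
      obtain ⟨ε, -, t₂, ht₂, hψα⟩ :=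
        stub_S1 hsq (ψQ n) xSqClass_eq_one_iff_exists_ψQ hρ hR hα₀
      obtain ⟨s, -, hF1⟩ := (h35 hn ρ hρ).2 hL0 (ΘA α₀) (generatesFreePart_of_twist ΘA hΘAmem hΘAsurj hα₀)
      have hF1E := step1E_fixed D hn ΘA ΘE hinter hF1 ht₂ hψα
      obtain ⟨Q₁, hQ₁⟩ := hK2 D R
      exact ⟨_, Q₁, s * ε, normE_map_embK D hn hβ (ΘE R) (hΘEminus R), hQ₁, hF1E⟩
  obtain ⟨R', Q₁, ε', hR0, hQ₁, hF1E⟩ := main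
  have hτ1ne : (tauOne : APoint D.H) ≠ 0 := Affine.Point.some_ne_zero _
  have hker : ∀ x, φH D x = 0 → x = 0 ∨ x = tauOne := fun x hx => (φH_eq_zero_iff D x).mp hx
  have hcomm := φH_normA D
  refine ⟨L, hL, ?_, ?_⟩
  · -- classes 5 and 7
    intro h57 h2L
    have hodd : Odd n := by rcases h57 with h | h <;> exact Nat.odd_iff.mpr (by omega)
    have hLe : Even L := even_iff_two_dvd.mpr h2L
    have htor : ∀ t : APoint D.H, IsOfFinAddOrder t →
        normA D t = (2 : ℕ) • t ∧ (2 : ℕ) • t ∈ AddSubgroup.zmultiples (tauOne : APoint D.H) := by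
      intro t ht
      refine ⟨by rw [normA_apply, stub_K4' D h318 hβ hodd t ht, two_nsmul], ?_⟩
      rcases (h318.1 hodd t ht).2 with h0 | h0
      · rw [h0]; exact zero_mem _
      · rw [h0]; exact AddSubgroup.mem_zmultiples _
    -- the `τa` of the class
    set τa : APoint D.H := if n % 8 = 5 then D.tauHalfOneMinusI else D.iPt D.tauHalfOneMinusI with hτa
    have hτa2 : (2 : ℕ) • τa = 0 := by rw [hτa]; split_ifs <;> assumption
    have hτanot : τa ∉ AddSubgroup.zmultiples (tauOne : APoint D.H) := by
      rw [hτa]; split_ifs <;> assumption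
    obtain ⟨a, k, hrel⟩ := stub_K5' D hsq h8 h34 h321 hβ
    rw [bSix_eq_zero_of_odd hodd, cI_eq_zero_of_odd hodd, Nat.cast_zero, zero_smul, zero_smul, add_zero,
      add_zero] at hrel
    rw [genusSum₂'_eq_brackets, bSix_eq_zero_of_odd hodd, add_zero]
    rcases h57 with h5' | h7'
    · rw [bFiveI_eq_zero_of_five h5', Nat.cast_zero, zero_smul, add_zero] at hrel
      rw [hτa, if_pos h5'] at hτa2 hτanot
      obtain ⟨h5, h7⟩ := W2.Abstract.even_brackets_odd (φH D) hτ1 hτ1ne hker hτa2 hτanot hτhalf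
        (normA D) (normE D) hcomm htor hR0 hQ₁ hF1E ⟨a, k, hrel⟩ hLe
      rw [genusSum₁_eq_bFivePlain h5', bFiveI_eq_zero_of_five h5', add_zero]
      exact ⟨h5, h5.add h7⟩
    · rw [bFivePlain_eq_zero_of_seven h7', Nat.cast_zero, zero_smul, zero_add] at hrel
      rw [hτa, if_neg (show ¬ n % 8 = 5 by omega)] at hτa2 hτanot
      obtain ⟨h5, h7⟩ := W2.Abstract.even_brackets_odd (φH D) hτ1 hτ1ne hker hτa2 hτanot hτhalf
        (normA D) (normE D) hcomm htor hR0 hQ₁ hF1E ⟨a, k, hrel⟩ hLe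
      rw [genusSum₁_eq_bSeven h7', bFivePlain_eq_zero_of_seven h7', zero_add]
      exact ⟨h7, h5.add h7⟩
  · -- class 6
    intro h6 h2L
    have heven : Even n := Nat.even_iff.mpr (by omega)
    have hLe : Even L := even_iff_two_dvd.mpr h2L
    have htor : ∀ t : APoint D.H, IsOfFinAddOrder t → (4 : ℕ) • t = 0 ∧ (2 : ℕ) • normA D t = 0 := by
      intro t ht
      have h4 := (h318.2 heven).1 t ht
      exact ⟨h4, by rw [normA_apply]; exact (hβ.2.2 heven).1 t h4⟩
    obtain ⟨a, k, hrel⟩ := stub_K5' D hsq h8 h34 h321 hβ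
    rw [bFivePlain_eq_zero_of_six h6, bFiveI_eq_zero_of_six h6, Nat.cast_zero, zero_smul, zero_smul,
      zero_add, zero_add] at hrel
    have key := W2.Abstract.even_iff_even_six (φH D) hτ1 hτ1ne hker hτhalf hτihalf hτia0
      (normA D) (normE D) hcomm htor hR0 hQ₁ hF1E ⟨a, k, hrel⟩ hLe
    rw [genusSum₂'_eq_brackets, bFivePlain_eq_zero_of_six h6, bFiveI_eq_zero_of_six h6, zero_add, zero_add]
    exact Nat.even_add.mpr key

end GPD

end Literature.NumberTheory.EllipticCurves.TianYuanZhang2017.W2
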